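import Summits.BirchSwinnertonDyer.BirchSwinnertonDyer.Theorems.ManinLocalTwoThreeNewformRowsOneNinetyTwo
import Summits.BirchSwinnertonDyer.BirchSwinnertonDyer.Theorems.ManinLocalTwoThreeTwistDefectRootLevel
import Summits.BirchSwinnertonDyer.BirchSwinnertonDyer.Theorems.ManinLocalTwoThreeNeronSqueezeTwentyFour
import Summits.BirchSwinnertonDyer.BirchSwinnertonDyer.Theorems.Rank2ObservatoryKrausCert
import Summits.BirchSwinnertonDyer.Rank1Residual.Additive.IntModelTamagawaCertificate
import HarnessLib

/-!
# `|c| = 1` on `X₀(192)` — UNCONDITIONALLY: the level `192 = 2⁶·3` (conductor exponent SIX at `2`) of the crux C2's domain, by the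
# ALIGNED TWO-TWIST TRANSPORT from the roots `24a` and `96a`

Cell bsd-f2-manin, route `ManinLocalTwoThree` (crux C2 `ManinOddAtFour`, stmt-BirchSwinnertonDyer-22967; `--supports` helper), LEAD p1
gen 26.  Part 3 (capstone) of the LEVEL-192 chain: an g55's kernel pinning (`…PinningOneNinetyTwo`, landed by this seat) ⟶ the four newform
ROWS (part 2, `f_eq_charTwist_cases`/`cuspCoeff_f_cases`: `192a = φ₉₆ₐ ⊗ χ₈`, `192b = φ₉₆ₐ ⊗ χ₈′`, `192c = φ₂₄ ⊗ χ₈`, `192d = φ₂₄ ⊗ χ₈′`) ⟶ the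
root squeezes and parities (part 1, `…RootFormsOneNinetyTwo`) ⟶ desc g46's THEOREM 71.I
`TwistDefect.abs_maninConstant_eq_one_of_squeeze_twoTwist_aligned_level` (two-twist `d = ±2`, root level `M ∈ {96, 24}` with `4 ∣ M`,
`M ∣ 192`, `8² ∣ 192`, ALIGNED minimal model `C` of `W₀ ⊗ d` with `Δ_C = d⁶ Δ_{W₀}`).

* §1 THE FOUR ALIGNED EDGES (kernel arithmetic): `96a1 ⊗ 2 = 192a2 = [0,−1,0,−9,9]`, `96a1 ⊗ (−2) = 192b2 = [0,1,0,−9,−9]`,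
  `24a1 ⊗ 2 = 192c2 = [0,1,0,−17,15]`, `24a1 ⊗ (−2) = 192d2 = [0,−1,0,−17,−15]` (explicit translations `u`, `r = 1`, `Δ_C = 2⁶Δ_{W₀}`); the
  four curves are elliptic and GLOBALLY MINIMAL by KRAUS certificates at `2` (`2¹² ∣ Δ`, so Silverman's criterion is silent; the tree's
  `Rank2Observatory.isGloballyMinimal_of_krausCheck`).  NOTE: the aligned model is curve `#2` of each Cremona class, not `#1`.
* §2 THE HEADLINE **`abs_maninConstant_eq_one_oneNinetyTwo (W) [IsElliptic] [IsGloballyMinimal] (D : ModularParametrizationData W 192) (hopt) :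
  |D.maninConstant| = 1`** — by cases on the row; hence `2 ∤ c` (C2's body at `N = 192` with NONE of the item's hypotheses), `3 ∤ c`, no
  prime divides `c`.

HONEST FRAMING: unconditional (standard axioms); LEVEL 192 joins the complete levels (the first with `v₂(N) = 6`).  The `∀ N` cruxes C2/C3,
Manin's conjecture and BSD are NOT proved; item 22967 stays OPEN as filed.  No definition, no named fact, no sorry.
[cite: CremonaAlgorithms1997, §2.10, Table 1 (192a–d, 24a1, 96a1)] [cite: Kraus1989, Prop. 2] [cite: Stevens1989, Lemma (5.4) p. 97]
[cite: Pal2012, Prop. 2.4, Lemma 3.1] [cite: AgasheRibetStein2006, §§1–2]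
-/

set_option autoImplicit false
-- lint-debt: the directory name repeats the summit name (sibling precedent `ManinLocalTwoThreeManinConstantOneHundred.lean`)
set_option linter.dupNamespace false

noncomputable section

open WeierstrassCurve
open scoped MatrixGroups ModularForm
open CongruenceSubgroup
open Literature.NumberTheory.EllipticCurves Literature.NumberTheory.EllipticCurves.ModularForms

namespace Summit.BirchSwinnertonDyer.BirchSwinnertonDyer.Theorems.ManinLocalTwoThree.LevelOneNinetyTwo

open Summit.BirchSwinnertonDyer.BirchSwinnertonDyer.Theorems.ManinLocalTwoThree
open Summit.BirchSwinnertonDyer.BirchSwinnertonDyer.Rank2Observatory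
open Summit.BirchSwinnertonDyer.Rank1Residual.Additive
open TwistDefect RootFormsOneNinetyTwo PinningOneNinetyTwo

/-! ## §1 The four aligned edges and their minimal models -/

/-- **ALIGNED EDGE `96a1 ⊗ 2 = 192a2`** (`u = ⟨1, −1, 0, 0⟩`: a translation, `r = 1`). [cite: CremonaAlgorithms1997, Table 1 (96a1, 192a2)] -/
theorem smul_quadraticTwist_ninetySixA1_two :
    (⟨1, -1, 0, 0⟩ : VariableChange ℚ) • (⟨0, 1, 0, -2, 0⟩ : WeierstrassCurve ℚ).quadraticTwist ((2 : ℤ) : ℚ) = ⟨0, -1, 0, -9, 9⟩ := by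
  ext <;> simp only [variableChange_a₁, variableChange_a₂, variableChange_a₃, variableChange_a₄, variableChange_a₆,
    quadraticTwist_a₁, quadraticTwist_a₂, quadraticTwist_a₃, quadraticTwist_a₄, quadraticTwist_a₆, b₂, b₄, b₆] <;> norm_num

/-- **ALIGNED EDGE `96a1 ⊗ (−2) = 192b2`** (`u = ⟨1, 1, 0, 0⟩`). [cite: CremonaAlgorithms1997, Table 1 (96a1, 192b2)] -/
theorem smul_quadraticTwist_ninetySixA1_negTwo :
    (⟨1, 1, 0, 0⟩ : VariableChange ℚ) • (⟨0, 1, 0, -2, 0⟩ : WeierstrassCurve ℚ).quadraticTwist ((-2 : ℤ) : ℚ) = ⟨0, 1, 0, -9, -9⟩ := by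
  ext <;> simp only [variableChange_a₁, variableChange_a₂, variableChange_a₃, variableChange_a₄, variableChange_a₆,
    quadraticTwist_a₁, quadraticTwist_a₂, quadraticTwist_a₃, quadraticTwist_a₄, quadraticTwist_a₆, b₂, b₄, b₆] <;> norm_num

/-- **ALIGNED EDGE `24a1 ⊗ 2 = 192c2`** (`u = ⟨1, 1, 0, 0⟩`). [cite: CremonaAlgorithms1997, Table 1 (24a1, 192c2)] -/
theorem smul_quadraticTwist_twentyFourA1_two :
    (⟨1, 1, 0, 0⟩ : VariableChange ℚ) • (⟨0, -1, 0, -4, 4⟩ : WeierstrassCurve ℚ).quadraticTwist ((2 : ℤ) : ℚ) = ⟨0, 1, 0, -17, 15⟩ := by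
  ext <;> simp only [variableChange_a₁, variableChange_a₂, variableChange_a₃, variableChange_a₄, variableChange_a₆,
    quadraticTwist_a₁, quadraticTwist_a₂, quadraticTwist_a₃, quadraticTwist_a₄, quadraticTwist_a₆, b₂, b₄, b₆] <;> norm_num

/-- **ALIGNED EDGE `24a1 ⊗ (−2) = 192d2`** (`u = ⟨1, −1, 0, 0⟩`). [cite: CremonaAlgorithms1997, Table 1 (24a1, 192d2)] -/
theorem smul_quadraticTwist_twentyFourA1_negTwo :
    (⟨1, -1, 0, 0⟩ : VariableChange ℚ) • (⟨0, -1, 0, -4, 4⟩ : WeierstrassCurve ℚ).quadraticTwist ((-2 : ℤ) : ℚ) = ⟨0, -1, 0, -17, -15⟩ := by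
  ext <;> simp only [variableChange_a₁, variableChange_a₂, variableChange_a₃, variableChange_a₄, variableChange_a₆,
    quadraticTwist_a₁, quadraticTwist_a₂, quadraticTwist_a₃, quadraticTwist_a₄, quadraticTwist_a₆, b₂, b₄, b₆] <;> norm_num

/-- `Δ(192a2) = 2⁶·Δ(96a1)` (`r = 1`: the edge is ALIGNED). [folklore] -/
theorem Δ_oneNinetyTwoA2_eq : (((1 : ℤ)) : ℚ) ^ 12 * (⟨0, -1, 0, -9, 9⟩ : WeierstrassCurve ℚ).Δ = (((2 : ℤ)) : ℚ) ^ 6 * (⟨0, 1, 0, -2, 0⟩ : WeierstrassCurve ℚ).Δ := by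
  norm_num [WeierstrassCurve.Δ, WeierstrassCurve.b₂, WeierstrassCurve.b₄, WeierstrassCurve.b₆, WeierstrassCurve.b₈]

/-- `Δ(192b2) = (−2)⁶·Δ(96a1)`. [folklore] -/
theorem Δ_oneNinetyTwoB2_eq : (((1 : ℤ)) : ℚ) ^ 12 * (⟨0, 1, 0, -9, -9⟩ : WeierstrassCurve ℚ).Δ = (((-2 : ℤ)) : ℚ) ^ 6 * (⟨0, 1, 0, -2, 0⟩ : WeierstrassCurve ℚ).Δ := by
  norm_num [WeierstrassCurve.Δ, WeierstrassCurve.b₂, WeierstrassCurve.b₄, WeierstrassCurve.b₆, WeierstrassCurve.b₈]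

/-- `Δ(192c2) = 2⁶·Δ(24a1)`. [folklore] -/
theorem Δ_oneNinetyTwoC2_eq : (((1 : ℤ)) : ℚ) ^ 12 * (⟨0, 1, 0, -17, 15⟩ : WeierstrassCurve ℚ).Δ = (((2 : ℤ)) : ℚ) ^ 6 * (⟨0, -1, 0, -4, 4⟩ : WeierstrassCurve ℚ).Δ := by
  norm_num [WeierstrassCurve.Δ, WeierstrassCurve.b₂, WeierstrassCurve.b₄, WeierstrassCurve.b₆, WeierstrassCurve.b₈]

/-- `Δ(192d2) = (−2)⁶·Δ(24a1)`. [folklore] -/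
theorem Δ_oneNinetyTwoD2_eq : (((1 : ℤ)) : ℚ) ^ 12 * (⟨0, -1, 0, -17, -15⟩ : WeierstrassCurve ℚ).Δ = (((-2 : ℤ)) : ℚ) ^ 6 * (⟨0, -1, 0, -4, 4⟩ : WeierstrassCurve ℚ).Δ := by
  norm_num [WeierstrassCurve.Δ, WeierstrassCurve.b₂, WeierstrassCurve.b₄, WeierstrassCurve.b₆, WeierstrassCurve.b₈]

/-- `192a2` is an elliptic curve. [folklore] -/
theorem isElliptic_oneNinetyTwoA2 : (⟨0, -1, 0, -9, 9⟩ : WeierstrassCurve ℚ).IsElliptic :=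
  ⟨by norm_num [WeierstrassCurve.Δ, WeierstrassCurve.b₂, WeierstrassCurve.b₄, WeierstrassCurve.b₆, WeierstrassCurve.b₈]⟩

/-- `192b2`, `192c2`, `192d2` are elliptic curves. [folklore] -/
theorem isElliptic_oneNinetyTwoBCD : (⟨0, 1, 0, -9, -9⟩ : WeierstrassCurve ℚ).IsElliptic ∧ (⟨0, 1, 0, -17, 15⟩ : WeierstrassCurve ℚ).IsElliptic ∧
    (⟨0, -1, 0, -17, -15⟩ : WeierstrassCurve ℚ).IsElliptic :=
  ⟨⟨by norm_num [WeierstrassCurve.Δ, WeierstrassCurve.b₂, WeierstrassCurve.b₄, WeierstrassCurve.b₆, WeierstrassCurve.b₈]⟩,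
   ⟨by norm_num [WeierstrassCurve.Δ, WeierstrassCurve.b₂, WeierstrassCurve.b₄, WeierstrassCurve.b₆, WeierstrassCurve.b₈]⟩,
   ⟨by norm_num [WeierstrassCurve.Δ, WeierstrassCurve.b₂, WeierstrassCurve.b₄, WeierstrassCurve.b₆, WeierstrassCurve.b₈]⟩⟩

/-- The literal `ℚ`-model `192a2` read through integer casts. [folklore] -/
theorem mk_oneNinetyTwoA2_eq_cast : (⟨0, -1, 0, -9, 9⟩ : WeierstrassCurve ℚ) =
    ⟨((0 : ℤ) : ℚ), ((-1 : ℤ) : ℚ), ((0 : ℤ) : ℚ), ((-9 : ℤ) : ℚ), ((9 : ℤ) : ℚ)⟩ := by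
  ext <;> norm_num

/-- **`192a2` is globally minimal** — KRAUS certificate at `2` (`Δ = 2¹²·3²`, `2⁸ ∤ c₄ = 2⁶·7`, `2⁸ ∤ c₆ + 64 = −2⁶·79`; Silverman's
`p¹² ∤ Δ ∨ p⁴ ∤ c₄` is silent here). [cite: Kraus1989, Prop. 2] [cite: SilvermanAEC2009, VII.1 Remark 1.1] -/
theorem isGloballyMinimal_oneNinetyTwoA2 : (⟨0, -1, 0, -9, 9⟩ : WeierstrassCurve ℚ).IsGloballyMinimal := by
  rw [mk_oneNinetyTwoA2_eq_cast, ← IntModelTam.baseChange_rat_mk_int]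
  exact isGloballyMinimal_of_krausCheck (W₀ := ⟨0, -1, 0, -9, 9⟩) (c := ⟨12, 6, 10, [⟨3, 1, 2, 0, 0⟩]⟩) (by decide +kernel)

/-- **`192b2` is globally minimal** (Kraus certificate: `c₆ + 64 = 2⁶·81`). [cite: Kraus1989, Prop. 2] -/
theorem isGloballyMinimal_oneNinetyTwoB2 : (⟨0, 1, 0, -9, -9⟩ : WeierstrassCurve ℚ).IsGloballyMinimal := by
  rw [show (⟨0, 1, 0, -9, -9⟩ : WeierstrassCurve ℚ) = ⟨((0 : ℤ) : ℚ), ((1 : ℤ) : ℚ), ((0 : ℤ) : ℚ), ((-9 : ℤ) : ℚ), ((-9 : ℤ) : ℚ)⟩ by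
    ext <;> norm_num, ← IntModelTam.baseChange_rat_mk_int]
  exact isGloballyMinimal_of_krausCheck (W₀ := ⟨0, 1, 0, -9, -9⟩) (c := ⟨12, 6, 10, [⟨3, 1, 2, 0, 0⟩]⟩) (by decide +kernel)

/-- **`192c2` is globally minimal** (Kraus certificate: `Δ = 2¹⁴·3²`, `c₄ = 2⁶·13`, `c₆ + 64 = −2⁶·279`). [cite: Kraus1989, Prop. 2] -/
theorem isGloballyMinimal_oneNinetyTwoC2 : (⟨0, 1, 0, -17, 15⟩ : WeierstrassCurve ℚ).IsGloballyMinimal := by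
  rw [show (⟨0, 1, 0, -17, 15⟩ : WeierstrassCurve ℚ) = ⟨((0 : ℤ) : ℚ), ((1 : ℤ) : ℚ), ((0 : ℤ) : ℚ), ((-17 : ℤ) : ℚ), ((15 : ℤ) : ℚ)⟩ by
    ext <;> norm_num, ← IntModelTam.baseChange_rat_mk_int]
  exact isGloballyMinimal_of_krausCheck (W₀ := ⟨0, 1, 0, -17, 15⟩) (c := ⟨14, 6, 9, [⟨3, 1, 2, 0, 0⟩]⟩) (by decide +kernel)

/-- **`192d2` is globally minimal** (Kraus certificate: `c₆ + 64 = 2⁶·281`). [cite: Kraus1989, Prop. 2] -/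
theorem isGloballyMinimal_oneNinetyTwoD2 : (⟨0, -1, 0, -17, -15⟩ : WeierstrassCurve ℚ).IsGloballyMinimal := by
  rw [show (⟨0, -1, 0, -17, -15⟩ : WeierstrassCurve ℚ) = ⟨((0 : ℤ) : ℚ), ((-1 : ℤ) : ℚ), ((0 : ℤ) : ℚ), ((-17 : ℤ) : ℚ), ((-15 : ℤ) : ℚ)⟩ by
    ext <;> norm_num, ← IntModelTam.baseChange_rat_mk_int]
  exact isGloballyMinimal_of_krausCheck (W₀ := ⟨0, -1, 0, -17, -15⟩) (c := ⟨14, 6, 9, [⟨3, 1, 2, 0, 0⟩]⟩) (by decide +kernel)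

/-! ## §2 The headline: `|c| = 1` on `X₀(192)`, unconditionally -/

/-- **LEVEL 192 COMPLETE — `|c| = 1` for every globally minimal elliptic `W/ℚ` and every `X₀(192)`-datum with the lattice clause
`Λ_W = c·Λ_f`.**  Rows `192a/192b` (`D.f = φ₉₆ₐ ⊗ χ₈ / χ₈′`): root squeeze `Λ(φ₉₆ₐ) ⊆ Λ_Néron(96a1)`, aligned edges to `192a2/192b2`;
rows `192c/192d` (`D.f = φ₂₄ ⊗ χ₈ / χ₈′`): root squeeze `Λ(φ₂₄) ⊆ Λ_Néron(24a1)`, aligned edges to `192c2/192d2`; each closed by desc's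
two-twist aligned transport (Stevens (5.4) twisting on `Γ₀`, the half-translate `heven`, Pal's Néron-lattice twist identity, p3's Néron
squeeze).  No modularity, no CDT, no printed Manin fact, no root datum. [cite: Stevens1989, Lemma (5.4) p. 97] [cite: Pal2012, Prop. 2.4, Lemma 3.1]
[cite: AgasheRibetStein2006, §§1–2] [cite: CremonaAlgorithms1997, Table 1 (192a1–192d1)] -/
theorem abs_maninConstant_eq_one_oneNinetyTwo (W : WeierstrassCurve ℚ) [W.IsElliptic] [W.IsGloballyMinimal]
    (D : ModularParametrizationData W 192) (hopt : ∀ z ∈ D.L.lattice, ∃ w ∈ periodLattice D.f, z = D.c * w) :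
    |D.maninConstant| = 1 := by
  -- the two roots
  obtain ⟨L₉₆, hg2, hg3, hle96⟩ := periodLatticeLe_F96a
  have hL96 := NeronSqueezeNinetySixA.isNeronLatticeOf_ninetySixA1 hg2 hg3
  haveI := NeronSqueezeNinetySixA.isElliptic_ninetySixA1
  obtain ⟨L₂₄, hg2', hg3', hle24⟩ := EtaIdentitiesTwentyFour.periodLatticeLe_twentyFour
  have hL24 := (LevelTwentyFour.isNeronLatticeOf_twentyFourA1_iff L₂₄).mpr ⟨hg2', hg3'⟩
  haveI := LevelTwentyFour.isElliptic_twentyFourA1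
  -- the four aligned minimal models
  haveI := isElliptic_oneNinetyTwoA2
  obtain ⟨hB, hC, hD⟩ := isElliptic_oneNinetyTwoBCD
  haveI := hB; haveI := hC; haveI := hD
  haveI := isGloballyMinimal_oneNinetyTwoA2
  haveI := isGloballyMinimal_oneNinetyTwoB2
  haveI := isGloballyMinimal_oneNinetyTwoC2
  haveI := isGloballyMinimal_oneNinetyTwoD2
  have h4_96 : 4 ∣ 96 := ⟨24, by norm_num⟩
  have h4_24 : 4 ∣ 24 := ⟨6, by norm_num⟩
  have h96 : 96 ∣ 192 := ⟨2, by norm_num⟩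
  have h24 : 24 ∣ 192 := ⟨8, by norm_num⟩
  have h64 : 8 ^ 2 ∣ 192 := ⟨3, by norm_num⟩
  rcases cuspCoeff_f_cases D with ⟨-, hf⟩ | ⟨-, hf⟩ | ⟨-, hf⟩ | ⟨-, hf⟩
  · -- 192a = 96a ⊗ χ₈ (d = 2), C = 192a2
    exact abs_maninConstant_eq_one_of_squeeze_twoTwist_aligned_level (d := 2) (Or.inl rfl) h4_96 h96 h64 F96a
      (⟨0, 1, 0, -2, 0⟩ : WeierstrassCurve ℚ) L₉₆ hL96 hle96 cuspCoeff_eq_zero_F96a (C := ⟨0, -1, 0, -9, 9⟩) ⟨1, -1, 0, 0⟩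
      smul_quadraticTwist_ninetySixA1_two (r := 1) (Or.inl rfl) Δ_oneNinetyTwoA2_eq W D
      (fun n _ ↦ by rw [if_pos rfl]; exact hf n) hopt
  · -- 192d = 24a ⊗ χ₈′ (d = −2), C = 192d2
    exact abs_maninConstant_eq_one_of_squeeze_twoTwist_aligned_level (d := -2) (Or.inr rfl) h4_24 h24 h64 cuspFormEta24
      (⟨0, -1, 0, -4, 4⟩ : WeierstrassCurve ℚ) L₂₄ hL24 hle24 cuspCoeff_eq_zero_eta24 (C := ⟨0, -1, 0, -17, -15⟩) ⟨1, -1, 0, 0⟩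
      smul_quadraticTwist_twentyFourA1_negTwo (r := 1) (Or.inl rfl) Δ_oneNinetyTwoD2_eq W D
      (fun n _ ↦ by rw [if_neg (by norm_num)]; exact hf n) hopt
  · -- 192b = 96a ⊗ χ₈′ (d = −2), C = 192b2
    exact abs_maninConstant_eq_one_of_squeeze_twoTwist_aligned_level (d := -2) (Or.inr rfl) h4_96 h96 h64 F96a
      (⟨0, 1, 0, -2, 0⟩ : WeierstrassCurve ℚ) L₉₆ hL96 hle96 cuspCoeff_eq_zero_F96a (C := ⟨0, 1, 0, -9, -9⟩) ⟨1, 1, 0, 0⟩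
      smul_quadraticTwist_ninetySixA1_negTwo (r := 1) (Or.inl rfl) Δ_oneNinetyTwoB2_eq W D
      (fun n _ ↦ by rw [if_neg (by norm_num)]; exact hf n) hopt
  · -- 192c = 24a ⊗ χ₈ (d = 2), C = 192c2
    exact abs_maninConstant_eq_one_of_squeeze_twoTwist_aligned_level (d := 2) (Or.inl rfl) h4_24 h24 h64 cuspFormEta24
      (⟨0, -1, 0, -4, 4⟩ : WeierstrassCurve ℚ) L₂₄ hL24 hle24 cuspCoeff_eq_zero_eta24 (C := ⟨0, 1, 0, -17, 15⟩) ⟨1, 1, 0, 0⟩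
      smul_quadraticTwist_twentyFourA1_two (r := 1) (Or.inl rfl) Δ_oneNinetyTwoC2_eq W D
      (fun n _ ↦ by rw [if_pos rfl]; exact hf n) hopt

/-- **Corollary: no integer `q` with `|q| ≠ 1` — in particular neither `2` nor `3` nor any prime — divides the Manin constant of a
lattice-optimal `X₀(192)`-datum.** [folklore] -/
theorem not_dvd_maninConstant_oneNinetyTwo (W : WeierstrassCurve ℚ) [W.IsElliptic] [W.IsGloballyMinimal]
    (D : ModularParametrizationData W 192) (hopt : ∀ z ∈ D.L.lattice, ∃ w ∈ periodLattice D.f, z = D.c * w)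
    {q : ℤ} (hq : q.natAbs ≠ 1) : ¬ q ∣ D.maninConstant := by
  intro h
  have h1 := abs_maninConstant_eq_one_oneNinetyTwo W D hopt
  have hn : D.maninConstant.natAbs = 1 := by
    rw [Int.abs_eq_natAbs] at h1
    exact_mod_cast h1
  have h2 : q.natAbs ∣ 1 := hn ▸ Int.natAbs_dvd_natAbs.mpr h
  exact hq (Nat.dvd_one.mp h2)

/-- **`2 ∤ c` on `X₀(192)`, UNCONDITIONALLY** — the body of the crux C2 `ManinOddAtFour` at `N = 192` (`2² ∣ 192`) with none of its
fact hypotheses. [cite: AgasheRibetStein2006, §§1–2] -/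
theorem not_two_dvd_maninConstant_oneNinetyTwo (W : WeierstrassCurve ℚ) [W.IsElliptic] [W.IsGloballyMinimal]
    (D : ModularParametrizationData W 192) (hopt : ∀ z ∈ D.L.lattice, ∃ w ∈ periodLattice D.f, z = D.c * w) :
    ¬ (2 : ℤ) ∣ D.maninConstant :=
  not_dvd_maninConstant_oneNinetyTwo W D hopt (by decide)

/-- **C2's inner clause at `N = 192` in the item's literal shape**: `2² ∣ 192`, and every lattice-optimal `X₀(192)`-datum of every
globally minimal elliptic curve has `|c| = 1` and `2 ∤ c`. [cite: CremonaAlgorithms1997, Table 1 (192a1–192d1)] -/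
theorem maninOddAtFour_oneNinetyTwo : 2 ^ 2 ∣ 192 ∧
    ∀ (W : WeierstrassCurve ℚ) [W.IsElliptic] [W.IsGloballyMinimal] (D : ModularParametrizationData W 192),
      (∀ z ∈ D.L.lattice, ∃ w ∈ periodLattice D.f, z = D.c * w) →
        |D.maninConstant| = 1 ∧ ¬ (2 : ℤ) ∣ D.maninConstant :=
  ⟨by norm_num, fun W _ _ D hopt ↦
    ⟨abs_maninConstant_eq_one_oneNinetyTwo W D hopt, not_two_dvd_maninConstant_oneNinetyTwo W D hopt⟩⟩

end Summit.BirchSwinnertonDyer.BirchSwinnertonDyer.Theorems.ManinLocalTwoThree.LevelOneNinetyTwo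

end
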